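import Literature.MathematicalPhysics.PowerSystems.DroopMicrogridLossySmallSignalStability

/-!
# Droop-controlled microgrid with `Q–V` dynamics: the synchronized motion PERSISTS under small
# conductances — implicit function theorem at a lossless equilibrium with positive definite reduced
# Hessian (Schiffer et al. 2014 §5.1/§5.4; Simpson-Porco–Dörfler–Bullo 2013, remark after Thm. 2)

Topic `Literature/MathematicalPhysics/PowerSystems` (LADDER-GRIDFUSION rung G3.b; seat gridfusion-lit-2,
g14).  Models: the lossless port-Hamiltonian droop microgrid `DroopPH n` (Shin–Zavala (9)) and its
LOSSY version `DroopLossy n` (the same closed loop with the power flows (1a)–(1b) of a Kron-reduced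
network with conductance matrix `G`; companion `DroopMicrogridLossyBoundedness.lean`, whose §5 typed
the synchronized motion (17) `(θ* + ω_s t𝟙, ω_s𝟙, V*)` and its power-flow equations
`isSolutionOn_syncMotion_iff`, and the lossy synchronization frequency `syncFrequency_eq`).
0 named facts, 0 sorry.

> [SchifferEtAl2014, §5.1 p0010 L1–L9] «Assumption 5.4. There exist constants δ^s, ω^s, V^s … such
> that [the power-flow equations of the synchronized state hold]. Under Assumption 5.4, the motion
> of the system (9), (1) starting in [x^s] is given by [(17)] … This desired motion is called
> synchronized motion and ω_s is the synchronization frequency.»  [§5.4 p0013 L27–L30] «in the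
> presence of small conductances, the synchronization frequency is given by … c_{1i} ≠ 0 …»
> [SimpsonporcoDorflerBullo2013, §3, remark after Theorem 2, p0010 L22] «regarding the assumption of
> purely inductive lines, we note that since the eigenvalues of a matrix are continuous functions of
> its entries, the exponential stability property established in Theorem 2 is robust, and the
> stable synchronous solution persists in the presence of sufficiently small line conductances
> [HDC-CCC:95 = Chiang–Chu 1995].»

The lossy rows of the lineage (★ `DroopMicrogridLossyBoundedness` / `…LossySmallSignalStability`)
take the synchronized state of the lossy model as GIVEN (Schiffer et al.'s Assumption 5.4).  This
file proves that it EXISTS, is locally unique, and depends differentiably on the conductances, near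
every lossless operating point that passes Prop. 5.9's Hessian test:

* §1 `withG` (the lossy model over `M` with conductances `G`), the unknowns `(θ, V, ω_s)` and their
  coordinate maps; `withG_P_apply` / `withG_Q_apply` (lossy flow = lossless flow + conductance terms).
* §2 **the synchronized-state map** `syncMap x* i₀ (G; θ, V, ω_s) = (P_i(θ,V;G) − P^u_i + ω_s/k_Pi,
  V_i + k_Qi(Q_i(θ,V;G) − Q^u_i), θ_{i₀} − θ*_{i₀})` — its zeros are exactly the synchronized motions
  of the lossy closed loop with the rotation pinned at the reference node (`syncMap_eq_zero_iff`, by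
  the companion's `isSolutionOn_syncMotion_iff`); it vanishes at `(0; θ*, V*, 0)` for a lossless
  equilibrium `x* = (θ*, 0, V*)` (`syncMap_base`).
* §3 `contDiff_syncMap`: `C¹` jointly in `(G, θ, V, ω_s)`.
* §4 **the Jacobian in the unknowns at `G = 0`**, `syncJac x i₀ (a, b, w) = (∂P_i(x)(a,0,b) + w/k_Pi,
  b_i + k_Qi ∂Q_i(x)(a,0,b), a_{i₀})` (`hasFDerivAt_syncMap_inr`, from the companion's `dP`, `dQ`);
  **`syncJac_injective`**: at an equilibrium with `V* > 0` and Hessian (15) positive definite on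
  `{v_θ,i₀ = 0}` it is injective — summing the active-power rows kills `w` (lossless `𝟙ᵀL = 𝟙ᵀW = 0`,
  companion `const_vecMul_hessL/W`), the voltage rows are `k_Qi V*_i` times the `V`-rows of (36)
  (voltage law `Q^u_i − Q_i = V*_i/k_Qi`, companion `dQ_eq_hess`), so `(a, b)` lies in the kernel of
  the block (36) in the gauge — hence invertible (`isInvertible_syncJac`, finite dimension).
* §5 **`exists_syncState_of_small_conductance`** (Mathlib's `HasStrictFDerivAt.implicitFunctionOf
  ProdDomain`): a map `Ψ : G ↦ (θ_G, V_G, ω_G)`, strictly differentiable at `0`, `Ψ(0) = (θ*, V*, 0)`,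
  such that for all `G` near `0` the synchronized motion `(θ_G + ω_G t𝟙, ω_G𝟙, V_G)` SOLVES the lossy
  closed loop with `V_G > 0` and `θ_G,i₀ = θ*_{i₀}`, and it is the only synchronized state near
  `(θ*, V*, 0)` in that gauge.

THREE COLUMNS / NOT CLAIMED.  MODELLED: models `DroopPH` / `DroopLossy` (Kron-reduced network,
first-order filters, constant inputs).  The neighbourhood of `G = 0` is existential (no conductance
bound is computed); STABILITY of the persisted synchronized motion (the other half of the SPDB2013
remark: eigenvalue continuity) is NOT proved here — for a given lossy instance it is the certificate
row `DroopLossy.expStable_modRotation_of_lyapunovCertificate`; nothing about loads or any microgrid.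

## References

* J. Schiffer, R. Ortega, A. Astolfi, J. Raisch, T. Sezi, *Conditions for stability of
  droop-controlled inverter-based microgrids*, Automatica 50 (2014): §5.1 Assumption 5.4, (17)–(19),
  Remarks 5.5–5.7 (held text p0010 L1–L21), §5.4 (p0013 L27–L30), §5.3 Prop. 5.9 (p0012).
  [SchifferEtAl2014]
* J. W. Simpson-Porco, F. Dörfler, F. Bullo, *Synchronization and power sharing for droop-controlled
  inverters in islanded microgrids*, Automatica 49 (2013) = arXiv:1206.5033: §3, remark after
  Theorem 2 (held text p0010 L22). [SimpsonporcoDorflerBullo2013]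
* S. Shin, V. M. Zavala, arXiv:2002.09802 (2020): (1a)–(1b), (9), (15), Remark 2. [ShinZavala2020]

AI-produced formalisation (LADDER-GRIDFUSION seat gridfusion-lit-2 g14, 2026-08-28).
-/

noncomputable section

open Set Filter Topology Finset Metric Real
open scoped Matrix BigOperators

namespace Literature.MathematicalPhysics.PowerSystems

namespace DroopPH

variable {n : ℕ} (M : DroopPH n)

/-! ## §1 The lossy model over a lossless one; the unknowns `(θ, V, ω_s)` of the synchronized state -/

/-- The lossy closed loop with the same filters, gains, inputs and susceptances as `M` and the
conductance matrix `G`. [cite: ShinZavala2020, §II-A eqs. (1a)–(1b); SchifferEtAl2014, eq. (1)] -/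
def withG (G : Fin n → Fin n → ℝ) : DroopLossy n := ⟨M, G⟩

/-- [cite: ShinZavala2020, §II-A eqs. (1a)–(1b)] -/
@[simp] theorem withG_G (G : Fin n → Fin n → ℝ) : (M.withG G).G = G := rfl
/-- [cite: ShinZavala2020, §II-A eqs. (1a)–(1b)] -/
@[simp] theorem withG_toDroopPH (G : Fin n → Fin n → ℝ) : (M.withG G).toDroopPH = M := rfl
/-- [cite: ShinZavala2020, §II-A eqs. (1a)–(1b)] -/
@[simp] theorem withG_B (G : Fin n → Fin n → ℝ) : (M.withG G).B = M.B := rfl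
/-- [cite: ShinZavala2020, §II-D (5)] -/
@[simp] theorem withG_kP (G : Fin n → Fin n → ℝ) : (M.withG G).kP = M.kP := rfl
/-- [cite: ShinZavala2020, §II-D (5)] -/
@[simp] theorem withG_kQ (G : Fin n → Fin n → ℝ) : (M.withG G).kQ = M.kQ := rfl
/-- [cite: ShinZavala2020, §II-D (4)] -/
@[simp] theorem withG_τP (G : Fin n → Fin n → ℝ) : (M.withG G).τP = M.τP := rfl
/-- [cite: ShinZavala2020, §II-D (4)] -/
@[simp] theorem withG_τQ (G : Fin n → Fin n → ℝ) : (M.withG G).τQ = M.τQ := rfl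
/-- [cite: ShinZavala2020, §II-D (5)] -/
@[simp] theorem withG_Pu (G : Fin n → Fin n → ℝ) : (M.withG G).Pu = M.Pu := rfl
/-- [cite: ShinZavala2020, §II-D (5)] -/
@[simp] theorem withG_Qu (G : Fin n → Fin n → ℝ) : (M.withG G).Qu = M.Qu := rfl

/-- Lossy active power = lossless one + conductance term. [cite: ShinZavala2020, eq. (1a)] -/
theorem withG_P_apply (G : Fin n → Fin n → ℝ) (θ V : Fin n → ℝ) (i : Fin n) :
    (M.withG G).P θ V i = M.P θ V i + ∑ j, V i * V j * G i j * cos (θ i - θ j) := by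
  simp only [DroopLossy.P, withG_G, DroopPH.P, ← Finset.sum_add_distrib]
  refine Finset.sum_congr rfl fun j _ => ?_
  show V i * V j * (G i j * cos (θ i - θ j) + M.B i j * sin (θ i - θ j)) = _
  ring

/-- Lossy reactive power = lossless one + conductance term. [cite: ShinZavala2020, eq. (1b)] -/
theorem withG_Q_apply (G : Fin n → Fin n → ℝ) (θ V : Fin n → ℝ) (i : Fin n) :
    (M.withG G).Q θ V i = M.Q θ V i + ∑ j, V i * V j * G i j * sin (θ i - θ j) := by
  simp only [DroopLossy.Q, withG_G, DroopPH.Q]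
  rw [← Finset.sum_neg_distrib, ← Finset.sum_add_distrib]
  refine Finset.sum_congr rfl fun j _ => ?_
  show V i * V j * (G i j * sin (θ i - θ j) - M.B i j * cos (θ i - θ j)) = _
  ring

/-- Unknowns of the synchronized state: angles, voltages, synchronization frequency `(θ, V, ω_s)`.
[cite: SchifferEtAl2014, §5.1 eq. (17)] -/
abbrev SyncUnk (n : ℕ) : Type := (Fin n → ℝ) × (Fin n → ℝ) × ℝ

/-- Parameter × unknowns: `(G, (θ, V, ω_s))`. [cite: SchifferEtAl2014, §5.1, §5.4] -/
abbrev SyncDom (n : ℕ) : Type := (Fin n → Fin n → ℝ) × SyncUnk n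

omit M in
/-- `(θ, V, ω) ↦ (θ, 0, V)`: the state attached to the synchronized unknowns (the power flows see
only `θ`, `V`). [cite: SchifferEtAl2014, §5.1 eq. (17)] -/
def unkEmbed (n : ℕ) : SyncUnk n →L[ℝ] State n :=
  (ContinuousLinearMap.fst ℝ (Fin n → ℝ) ((Fin n → ℝ) × ℝ)).prod
    ((0 : SyncUnk n →L[ℝ] (Fin n → ℝ)).prod
      ((ContinuousLinearMap.fst ℝ (Fin n → ℝ) ℝ).comp (ContinuousLinearMap.snd ℝ (Fin n → ℝ) ((Fin n → ℝ) × ℝ))))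

omit M in
/-- [cite: SchifferEtAl2014, §5.1 eq. (17)] -/
@[simp] theorem unkEmbed_apply (y : SyncUnk n) : unkEmbed n y = (y.1, 0, y.2.1) := by
  simp [unkEmbed]

omit M in
/-- The frequency coordinate `(θ, V, ω) ↦ ω`. [cite: SchifferEtAl2014, §5.1 eq. (17)] -/
def omegaCLM (n : ℕ) : SyncUnk n →L[ℝ] ℝ :=
  (ContinuousLinearMap.snd ℝ (Fin n → ℝ) ℝ).comp (ContinuousLinearMap.snd ℝ (Fin n → ℝ) ((Fin n → ℝ) × ℝ))

omit M in
/-- [cite: SchifferEtAl2014, §5.1 eq. (17)] -/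
@[simp] theorem omegaCLM_apply (y : SyncUnk n) : omegaCLM n y = y.2.2 := by simp [omegaCLM]

omit M in
/-- A voltage coordinate `(θ, V, ω) ↦ V_i`. [cite: SchifferEtAl2014, §5.1 eq. (17)] -/
def voltCLM (i : Fin n) : SyncUnk n →L[ℝ] ℝ :=
  (ContinuousLinearMap.proj (R := ℝ) (φ := fun _ : Fin n => ℝ) i).comp
    ((ContinuousLinearMap.fst ℝ (Fin n → ℝ) ℝ).comp (ContinuousLinearMap.snd ℝ (Fin n → ℝ) ((Fin n → ℝ) × ℝ)))

omit M in
/-- [cite: SchifferEtAl2014, §5.1 eq. (17)] -/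
@[simp] theorem voltCLM_apply (i : Fin n) (y : SyncUnk n) : voltCLM i y = y.2.1 i := by
  simp [voltCLM]

omit M in
/-- An angle coordinate `(θ, V, ω) ↦ θ_i`. [cite: SchifferEtAl2014, §5 (reference node)] -/
def angCLM (i : Fin n) : SyncUnk n →L[ℝ] ℝ :=
  (ContinuousLinearMap.proj (R := ℝ) (φ := fun _ : Fin n => ℝ) i).comp
    (ContinuousLinearMap.fst ℝ (Fin n → ℝ) ((Fin n → ℝ) × ℝ))

omit M in
/-- [cite: SchifferEtAl2014, §5 (reference node)] -/
@[simp] theorem angCLM_apply (i : Fin n) (y : SyncUnk n) : angCLM i y = y.1 i := by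
  simp [angCLM]

/-! ## §2 The steady-state map of the synchronized motion, gauge-fixed at a reference node -/

/-- **The synchronized-state map** `Φ(G; θ, V, ω_s)`: the power-flow equations of a synchronized
motion of the lossy closed loop — `P_i(θ, V; G) − P^u_i + ω_s/k_Pi` and `V_i + k_Qi(Q_i(θ, V; G) −
Q^u_i)` («replacing the synchronized motion (17) in (7)») — together with the gauge condition
`θ_{i₀} − θ*_{i₀}` pinning the rotation. Its zeros are the synchronized motions with reference angle
`θ*_{i₀}` (`syncMap_eq_zero_iff`). [cite: SchifferEtAl2014, §5.1 (17)–(19), Remark 5.5, Remark 5.7 (rotational family)] -/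
def syncMap (xs : State n) (i₀ : Fin n) (p : SyncDom n) : SyncUnk n :=
  (fun i => (M.withG p.1).P p.2.1 p.2.2.1 i - M.Pu i + p.2.2.2 / M.kP i,
   fun i => p.2.2.1 i + M.kQ i * ((M.withG p.1).Q p.2.1 p.2.2.1 i - M.Qu i),
   p.2.1 i₀ - xs.1 i₀)

/-- **Zeros of the synchronized-state map = synchronized motions in the gauge** (`k_P, τ > 0`):
`Φ(G; θ, V, ω) = 0` iff the synchronized motion `(θ + ωt𝟙, ω𝟙, V)` solves the lossy closed loop with
conductances `G` (companion `isSolutionOn_syncMotion_iff`) and `θ_{i₀} = θ*_{i₀}`.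
[cite: SchifferEtAl2014, §5.1 (17)–(19) and Remark 5.5] -/
theorem syncMap_eq_zero_iff (hkP : ∀ i, 0 < M.kP i) (hτP : ∀ i, 0 < M.τP i)
    (hτQ : ∀ i, 0 < M.τQ i) (xs : State n) (i₀ : Fin n) (G : Fin n → Fin n → ℝ) (y : SyncUnk n) :
    M.syncMap xs i₀ (G, y) = 0 ↔
      (∀ T : ℝ, (M.withG G).IsSolutionOn (DroopLossy.syncMotion y.1 y.2.2 y.2.1) (Icc 0 T)) ∧
        y.1 i₀ = xs.1 i₀ := by
  rw [(M.withG G).isSolutionOn_syncMotion_iff hτP hτQ]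
  simp only [withG_kP, withG_kQ, withG_Pu, withG_Qu]
  constructor
  · intro h
    have h1 : ∀ i, (M.withG G).P y.1 y.2.1 i - M.Pu i + y.2.2 / M.kP i = 0 := fun i =>
      congrFun (congrArg Prod.fst h) i
    have h2 : ∀ i, y.2.1 i + M.kQ i * ((M.withG G).Q y.1 y.2.1 i - M.Qu i) = 0 := fun i =>
      congrFun (congrArg (fun z => z.2.1) h) i
    have h3 : y.1 i₀ - xs.1 i₀ = 0 := congrArg (fun z => z.2.2) h
    refine ⟨⟨fun i => ?_, fun i => h2 i⟩, sub_eq_zero.1 h3⟩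
    have hk := hkP i
    have := h1 i
    field_simp at this
    show y.2.2 + M.kP i * ((M.withG G).P y.1 y.2.1 i - M.Pu i) = 0
    nlinarith [this]
  · rintro ⟨⟨h1, h2⟩, h3⟩
    refine Prod.ext (funext fun i => ?_) (Prod.ext (funext fun i => h2 i) (sub_eq_zero.2 h3))
    have hk := (hkP i).ne'
    have := h1 i
    show (M.withG G).P y.1 y.2.1 i - M.Pu i + y.2.2 / M.kP i = 0
    field_simp
    linear_combination this

/-- At `G = 0` and the lossless equilibrium `x* = (θ*, 0, V*)` the map vanishes at `(θ*, V*, 0)`.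
[cite: SchifferEtAl2014, Remark 5.5 (ω_s = 0 in the balanced lossless frame); ShinZavala2020, (9)] -/
theorem syncMap_base (hkP : ∀ i, 0 < M.kP i) (hτP : ∀ i, 0 < M.τP i) (hτQ : ∀ i, 0 < M.τQ i)
    {xs : State n} (heq : M.field xs = 0) (i₀ : Fin n) :
    M.syncMap xs i₀ (0, (xs.1, xs.2.2, 0)) = 0 := by
  obtain ⟨-, hP, hV⟩ := (M.field_eq_zero_iff_steady xs (fun i => (hkP i).ne') (fun i => (hτP i).ne')
    (fun i => (hτQ i).ne')).1 heq
  refine Prod.ext (funext fun i => ?_) (Prod.ext (funext fun i => ?_) ?_)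
  · show (M.withG 0).P xs.1 xs.2.2 i - M.Pu i + 0 / M.kP i = 0
    rw [M.withG_P_apply]; simp [hP i]
  · show xs.2.2 i + M.kQ i * ((M.withG 0).Q xs.1 xs.2.2 i - M.Qu i) = 0
    rw [M.withG_Q_apply]; simpa using hV i
  · show xs.1 i₀ - xs.1 i₀ = 0
    exact sub_self _

/-! ## §3 The map is `C¹` jointly in the conductances and the unknowns -/

/-- The synchronized-state map is `C¹` (polynomial in `G`, `V`, `ω`, trigonometric in `θ`).
[cite: ShinZavala2020, eqs. (1a)–(1b)] -/
theorem contDiff_syncMap (xs : State n) (i₀ : Fin n) : ContDiff ℝ 1 (M.syncMap xs i₀) := by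
  have hG : ∀ i j, ContDiff ℝ 1 fun p : SyncDom n => p.1 i j := fun i j =>
    (contDiff_apply ℝ ℝ j).comp ((contDiff_apply ℝ (Fin n → ℝ) i).comp contDiff_fst)
  have hθ : ∀ k, ContDiff ℝ 1 fun p : SyncDom n => p.2.1 k := fun k =>
    (contDiff_apply ℝ ℝ k).comp (contDiff_fst.comp contDiff_snd)
  have hV : ∀ k, ContDiff ℝ 1 fun p : SyncDom n => p.2.2.1 k := fun k =>
    (contDiff_apply ℝ ℝ k).comp (contDiff_fst.comp (contDiff_snd.comp contDiff_snd))
  have hω : ContDiff ℝ 1 fun p : SyncDom n => p.2.2.2 :=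
    contDiff_snd.comp (contDiff_snd.comp contDiff_snd)
  have hP : ∀ i, ContDiff ℝ 1 fun p : SyncDom n => (M.withG p.1).P p.2.1 p.2.2.1 i := by
    intro i
    simp only [DroopLossy.P, withG_G, withG_B]
    exact ContDiff.sum fun j _ => ((hV i).mul (hV j)).mul
      ((((hG i j).mul (((hθ i).sub (hθ j)).cos))).add (contDiff_const.mul (((hθ i).sub (hθ j)).sin)))
  have hQ : ∀ i, ContDiff ℝ 1 fun p : SyncDom n => (M.withG p.1).Q p.2.1 p.2.2.1 i := by
    intro i
    simp only [DroopLossy.Q, withG_G, withG_B]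
    exact ContDiff.sum fun j _ => ((hV i).mul (hV j)).mul
      ((((hG i j).mul (((hθ i).sub (hθ j)).sin))).sub (contDiff_const.mul (((hθ i).sub (hθ j)).cos)))
  refine (contDiff_pi.2 fun i => ?_).prodMk ((contDiff_pi.2 fun i => ?_).prodMk ?_)
  · exact ((hP i).sub contDiff_const).add (hω.div_const _)
  · exact (hV i).add (contDiff_const.mul ((hQ i).sub contDiff_const))
  · exact (hθ i₀).sub contDiff_const

/-! ## §4 The Jacobian of the synchronized-state map in the unknowns at `G = 0`, its injectivity
at an equilibrium with positive definite reduced Hessian, and its invertibility -/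

/-- **The Jacobian `∂Φ/∂(θ, V, ω_s)` at `G = 0`** and the state `x = (θ, 0, V)`:
`(a, b, w) ↦ ( ∂P_i(x)(a, 0, b) + w/k_Pi , b_i + k_Qi ∂Q_i(x)(a, 0, b) , a_{i₀} )` (companion `dP`,
`dQ` = the rows `(L | 0 | W)` and `V_i(Wᵀ | 0 | D + T) − ((Q^u − Q)/V)·` of (15)).
[cite: ShinZavala2020, §IV-A eq. (15), Remark 2 (Jacobian); SchifferEtAl2014, (35)–(36)] -/
def syncJac (x : State n) (i₀ : Fin n) : SyncUnk n →L[ℝ] SyncUnk n :=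
  (ContinuousLinearMap.pi fun i => (M.dP x i).comp (unkEmbed n) + (M.kP i)⁻¹ • omegaCLM n).prod
    ((ContinuousLinearMap.pi fun i => voltCLM i + M.kQ i • (M.dQ x i).comp (unkEmbed n)).prod
      (angCLM i₀))

/-- [cite: ShinZavala2020, §IV-A eq. (15)] -/
theorem syncJac_apply (x : State n) (i₀ : Fin n) (y : SyncUnk n) :
    M.syncJac x i₀ y
      = (fun i => M.dP x i (y.1, 0, y.2.1) + y.2.2 / M.kP i,
         fun i => y.2.1 i + M.kQ i * M.dQ x i (y.1, 0, y.2.1), y.1 i₀) := by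
  refine Prod.ext (funext fun i => ?_) (Prod.ext (funext fun i => ?_) ?_)
  · simp [syncJac, div_eq_inv_mul]
  · simp [syncJac]
  · simp [syncJac]

/-- **`∂Φ/∂(θ, V, ω_s)(0; θ, V, ω) = syncJac (θ, 0, V)`**: the partial derivative of the
synchronized-state map in the unknowns at zero conductances. [cite: ShinZavala2020, eqs. (1a)–(1b), (15)] -/
theorem hasFDerivAt_syncMap_inr (xs : State n) (i₀ : Fin n) (y₀ : SyncUnk n) :
    HasFDerivAt (fun y : SyncUnk n => M.syncMap xs i₀ (0, y))
      (M.syncJac (y₀.1, 0, y₀.2.1) i₀) y₀ := by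
  have hE : ∀ y : SyncUnk n, unkEmbed n y = (y.1, 0, y.2.1) := unkEmbed_apply
  -- the three blocks
  have hP : ∀ i, HasFDerivAt (fun y : SyncUnk n => M.P y.1 y.2.1 i)
      ((M.dP (y₀.1, 0, y₀.2.1) i).comp (unkEmbed n)) y₀ := by
    intro i
    have h := (M.hasFDerivAt_P (unkEmbed n y₀) i).comp y₀ (unkEmbed n).hasFDerivAt
    simp only [hE] at h
    exact h
  have hQ : ∀ i, HasFDerivAt (fun y : SyncUnk n => M.Q y.1 y.2.1 i)
      ((M.dQ (y₀.1, 0, y₀.2.1) i).comp (unkEmbed n)) y₀ := by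
    intro i
    have h := (M.hasFDerivAt_Q (unkEmbed n y₀) i).comp y₀ (unkEmbed n).hasFDerivAt
    simp only [hE] at h
    exact h
  have h1 : ∀ i, HasFDerivAt (fun y : SyncUnk n => (M.withG 0).P y.1 y.2.1 i - M.Pu i + y.2.2 / M.kP i)
      ((M.dP (y₀.1, 0, y₀.2.1) i).comp (unkEmbed n) + (M.kP i)⁻¹ • omegaCLM n) y₀ := by
    intro i
    have hω : HasFDerivAt (fun y : SyncUnk n => y.2.2 / M.kP i) ((M.kP i)⁻¹ • omegaCLM n) y₀ := by
      have := ((omegaCLM n).hasFDerivAt (x := y₀)).const_mul (M.kP i)⁻¹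
      refine this.congr_of_eventuallyEq (Filter.Eventually.of_forall fun y => ?_)
      simp [div_eq_inv_mul]
    have h := ((hP i).sub_const (M.Pu i)).add hω
    refine h.congr_of_eventuallyEq (Filter.Eventually.of_forall fun y => ?_)
    simp [M.withG_P_apply]
  have h2 : ∀ i, HasFDerivAt
      (fun y : SyncUnk n => y.2.1 i + M.kQ i * ((M.withG 0).Q y.1 y.2.1 i - M.Qu i))
      (voltCLM i + M.kQ i • (M.dQ (y₀.1, 0, y₀.2.1) i).comp (unkEmbed n)) y₀ := by
    intro i
    have hv : HasFDerivAt (fun y : SyncUnk n => y.2.1 i) (voltCLM i) y₀ := by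
      have := (voltCLM (n := n) i).hasFDerivAt (x := y₀)
      refine this.congr_of_eventuallyEq (Filter.Eventually.of_forall fun y => ?_)
      simp
    have h := hv.add (((hQ i).sub_const (M.Qu i)).const_mul (M.kQ i))
    refine h.congr_of_eventuallyEq (Filter.Eventually.of_forall fun y => ?_)
    simp [M.withG_Q_apply]
  have h3 : HasFDerivAt (fun y : SyncUnk n => y.1 i₀ - xs.1 i₀) (angCLM i₀) y₀ := by
    have := ((angCLM (n := n) i₀).hasFDerivAt (x := y₀)).sub_const (xs.1 i₀)
    refine this.congr_of_eventuallyEq (Filter.Eventually.of_forall fun y => ?_)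
    simp
  exact (hasFDerivAt_pi.2 h1).prodMk ((hasFDerivAt_pi.2 h2).prodMk h3)

/-- **The Jacobian in the unknowns is INJECTIVE at a lossless equilibrium with positive definite
reduced Hessian.**  `B` symmetric, positive gains and time constants, `x* = (θ*, 0, V*)` an
equilibrium of (9) with `V* > 0` and Hessian (15) positive definite on `{v_θ,i₀ = 0}`: if
`syncJac x* i₀ (a, b, w) = 0` then — summing the active-power rows (lossless: `𝟙ᵀL = 0`,
`𝟙ᵀW = 0`) — `wΣ_i k_Pi⁻¹ = 0`, so `w = 0`; the voltage rows give `Wᵀa + (D + T)b = 0` (voltage law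
`Q^u_i − Q_i = V_i/k_Qi` at `x*`); hence `(a, b)` is in the kernel of the block (36) with `a_{i₀} = 0`,
so `a = b = 0`. [cite: SchifferEtAl2014, proof of Proposition 5.9 ((35)–(36) positive definite), Remark 5.5 («adding up all the nodes»); ShinZavala2020, eq. (15)] -/
theorem syncJac_injective (hB : ∀ i j, M.B i j = M.B j i) (hkP : ∀ i, 0 < M.kP i)
    (hτP : ∀ i, 0 < M.τP i) (hkQ : ∀ i, 0 < M.kQ i) (hτQ : ∀ i, 0 < M.τQ i) {xs : State n}
    (heq : M.field xs = 0) (hV : ∀ i, 0 < xs.2.2 i) (i₀ : Fin n)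
    (hpos : ∀ v : State n, v.1 i₀ = 0 → v ≠ 0 → 0 < pair v (M.hessCLM xs v)) :
    Function.Injective (M.syncJac xs i₀) := by
  have hV0 : ∀ i, xs.2.2 i ≠ 0 := fun i => (hV i).ne'
  obtain ⟨hω, -, hVlaw⟩ := (M.field_eq_zero_iff_steady xs (fun i => (hkP i).ne')
    (fun i => (hτP i).ne') (fun i => (hτQ i).ne')).1 heq
  have hxs : ((xs.1, 0, xs.2.2) : State n) = xs :=
    Prod.ext rfl (Prod.ext (funext fun i => (hω i).symm) rfl)
  rw [injective_iff_map_eq_zero]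
  rintro ⟨a, b, w⟩ hK
  rw [M.syncJac_apply] at hK
  have h1 : ∀ i, M.dP xs i (a, 0, b) + w / M.kP i = 0 := fun i => congrFun (congrArg Prod.fst hK) i
  have h2 : ∀ i, b i + M.kQ i * M.dQ xs i (a, 0, b) = 0 := fun i =>
    congrFun (congrArg (fun z => z.2.1) hK) i
  have h3 : a i₀ = 0 := congrArg (fun z => z.2.2) hK
  -- rows in Hessian form
  have h1' : ∀ i, (M.hessL xs *ᵥ a) i + (M.hessW xs *ᵥ b) i + w / M.kP i = 0 := by
    intro i; have := h1 i; rwa [M.dP_eq_hess] at this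
  have h2' : ∀ i, ((M.hessW xs)ᵀ *ᵥ a) i + ((M.hessD xs + M.hessT xs) *ᵥ b) i = 0 := by
    intro i
    have h := h2 i
    rw [M.dQ_eq_hess hB xs (a, 0, b) (hV0 i)] at h
    have hk := (hkQ i).ne'
    have hVi : xs.2.2 i ≠ 0 := hV0 i
    have hq : (M.Qu i - M.Q xs.1 xs.2.2 i) / xs.2.2 i = 1 / M.kQ i := by
      have := hVlaw i
      rw [div_eq_div_iff hVi hk]
      linear_combination (-1 : ℝ) * this
    rw [hq] at h
    simp only at h
    have e : M.kQ i * (1 / M.kQ i) = 1 := by field_simp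
    have h' : M.kQ i * xs.2.2 i
        * (((M.hessW xs)ᵀ *ᵥ a) i + ((M.hessD xs + M.hessT xs) *ᵥ b) i) = 0 := by
      linear_combination h + b i * e
    exact (mul_eq_zero.1 h').resolve_left (mul_ne_zero hk hVi)
  -- w = 0 by summing the active-power rows
  have hw : w = 0 := by
    have hsum : ∑ i, ((M.hessL xs *ᵥ a) i + (M.hessW xs *ᵥ b) i + w / M.kP i) = 0 :=
      Finset.sum_eq_zero fun i _ => h1' i
    have hL : ∑ i, (M.hessL xs *ᵥ a) i = 0 := by
      have := congrArg (fun v => v ⬝ᵥ a) (M.const_vecMul_hessL hB xs 1)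
      simp only [zero_dotProduct] at this
      rw [← Matrix.dotProduct_mulVec] at this
      simpa [dotProduct] using this
    have hW : ∑ i, (M.hessW xs *ᵥ b) i = 0 := by
      have := congrArg (fun v => v ⬝ᵥ b) (M.const_vecMul_hessW hB xs 1)
      simp only [zero_dotProduct] at this
      rw [← Matrix.dotProduct_mulVec] at this
      simpa [dotProduct] using this
    rw [Finset.sum_add_distrib, Finset.sum_add_distrib, hL, hW, zero_add, zero_add] at hsum
    have hσ : 0 < ∑ i, 1 / M.kP i :=
      Finset.sum_pos (fun i _ => one_div_pos.2 (hkP i)) ⟨i₀, Finset.mem_univ _⟩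
    have : w * ∑ i, 1 / M.kP i = 0 := by
      rw [Finset.mul_sum]
      simp_rw [mul_one_div]
      exact hsum
    rcases mul_eq_zero.1 this with h | h
    · exact h
    · exact absurd h hσ.ne'
  -- (a, b) in the kernel of (36), gauge a i₀ = 0 ⇒ a = b = 0
  have hLW : ∀ i, (M.hessL xs *ᵥ a) i + (M.hessW xs *ᵥ b) i = 0 := fun i => by
    have := h1' i; rw [hw, zero_div, add_zero] at this; exact this
  have hform : Sum.elim a b ⬝ᵥ (M.hessThetaV xs *ᵥ Sum.elim a b) = 0 := by
    rw [hessThetaV, Matrix.fromBlocks_mulVec, Sum.elim_comp_inl, Sum.elim_comp_inr,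
      sumElim_dotProduct_sumElim]
    have e1 : M.hessL xs *ᵥ a + M.hessW xs *ᵥ b = 0 := funext fun i => hLW i
    have e2 : (M.hessW xs)ᵀ *ᵥ a + (M.hessD xs + M.hessT xs) *ᵥ b = 0 := funext fun i => h2' i
    rw [e1, e2, dotProduct_zero, dotProduct_zero, add_zero]
  have hab : a = 0 ∧ b = 0 := by
    by_contra hne
    have hv : ((a, 0, b) : State n) ≠ 0 := by
      intro h0
      apply hne
      exact ⟨congrArg Prod.fst h0, congrArg (fun z => z.2.2) h0⟩
    have hp := hpos (a, 0, b) h3 hv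
    rw [M.pair_hessCLM_eq_blocks hB xs hV0] at hp
    simp only at hp
    rw [hform, Matrix.mulVec_zero, dotProduct_zero, add_zero] at hp
    exact lt_irrefl _ hp
  obtain ⟨ha, hb⟩ := hab
  subst ha; subst hb; subst hw
  rfl

/-- **Hence the Jacobian in the unknowns is INVERTIBLE** (injective endomorphism of a
finite-dimensional space). [cite: SchifferEtAl2014, proof of Proposition 5.9; ShinZavala2020, Remark 2] -/
theorem isInvertible_syncJac (hB : ∀ i j, M.B i j = M.B j i) (hkP : ∀ i, 0 < M.kP i)
    (hτP : ∀ i, 0 < M.τP i) (hkQ : ∀ i, 0 < M.kQ i) (hτQ : ∀ i, 0 < M.τQ i) {xs : State n}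
    (heq : M.field xs = 0) (hV : ∀ i, 0 < xs.2.2 i) (i₀ : Fin n)
    (hpos : ∀ v : State n, v.1 i₀ = 0 → v ≠ 0 → 0 < pair v (M.hessCLM xs v)) :
    (M.syncJac xs i₀).IsInvertible := by
  have hinj := M.syncJac_injective hB hkP hτP hkQ hτQ heq hV i₀ hpos
  have hinj' : Function.Injective (M.syncJac xs i₀).toLinearMap := fun a b h => hinj h
  have hsurj' : Function.Surjective (M.syncJac xs i₀).toLinearMap :=
    LinearMap.injective_iff_surjective.1 hinj'
  refine ⟨ContinuousLinearEquiv.ofBijective (M.syncJac xs i₀) ?_ ?_,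
    ContinuousLinearEquiv.coe_ofBijective _ _ _⟩
  · exact LinearMap.ker_eq_bot.2 hinj'
  · exact LinearMap.range_eq_top.2 hsurj'

/-! ## §5 The implicit function theorem: synchronized motions persist for small conductances -/

/-- **PERSISTENCE OF THE SYNCHRONIZED MOTION UNDER SMALL CONDUCTANCES** (implicit function theorem).
`B` symmetric, positive gains and time constants; `x* = (θ*, 0, V*)` an equilibrium of the LOSSLESS
model (9) with `V* > 0` whose Hessian (15) is positive definite on `{v_θ,i₀ = 0}` (Prop. 5.9's
hypothesis, e.g. by the small-angle scalar test).  Then there is a map `Ψ : G ↦ (θ_G, V_G, ω_G)` on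
the conductance matrices, strictly differentiable at `G = 0` with `Ψ(0) = (θ*, V*, 0)`, such that
for all `G` in a neighbourhood of `0`: `V_G > 0`, `θ_G` keeps the reference angle `θ*_{i₀}`, and the
SYNCHRONIZED MOTION `(θ_G + ω_G t𝟙, ω_G𝟙, V_G)` solves the lossy closed loop (9), (1) with conductances
`G` («the stable synchronous solution persists in the presence of sufficiently small line
conductances»; the synchronization frequency `ω_G` is the one of the companion's `syncFrequency_eq`);
moreover it is the ONLY synchronized state near `(θ*, V*, 0)` in that gauge (`syncState_unique_near`).
[cite: SimpsonporcoDorflerBullo2013, §3 remark after Theorem 2 (p0010 L22: «the exponential stability property … is robust, and the stable synchronous solution persists in the presence of sufficiently small line conductances [HDC-CCC:95]»); SchifferEtAl2014, §5.1 Assumption 5.4 and (17), Remark 5.5, §5.4 (p0013 L27–L30: «in the presence of small conductances, the synchronization frequency is given by …»)] -/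
theorem exists_syncState_of_small_conductance (hB : ∀ i j, M.B i j = M.B j i)
    (hkP : ∀ i, 0 < M.kP i) (hτP : ∀ i, 0 < M.τP i) (hkQ : ∀ i, 0 < M.kQ i) (hτQ : ∀ i, 0 < M.τQ i)
    {xs : State n} (heq : M.field xs = 0) (hV : ∀ i, 0 < xs.2.2 i) (i₀ : Fin n)
    (hpos : ∀ v : State n, v.1 i₀ = 0 → v ≠ 0 → 0 < pair v (M.hessCLM xs v)) :
    ∃ Ψ : (Fin n → Fin n → ℝ) → SyncUnk n,
      Ψ 0 = (xs.1, xs.2.2, 0) ∧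
      (∃ L : (Fin n → Fin n → ℝ) →L[ℝ] SyncUnk n, HasStrictFDerivAt Ψ L 0) ∧
      (∀ᶠ G in 𝓝 (0 : Fin n → Fin n → ℝ),
        (∀ i, 0 < (Ψ G).2.1 i) ∧ (Ψ G).1 i₀ = xs.1 i₀ ∧
        ∀ T : ℝ, (M.withG G).IsSolutionOn
          (DroopLossy.syncMotion (Ψ G).1 (Ψ G).2.2 (Ψ G).2.1) (Icc 0 T)) ∧
      (∀ᶠ p in 𝓝 ((0 : Fin n → Fin n → ℝ), ((xs.1, xs.2.2, (0 : ℝ)) : SyncUnk n)),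
        ((∀ T : ℝ, (M.withG p.1).IsSolutionOn
            (DroopLossy.syncMotion p.2.1 p.2.2.2 p.2.2.1) (Icc 0 T)) ∧ p.2.1 i₀ = xs.1 i₀)
          ↔ Ψ p.1 = p.2) := by
  obtain ⟨hω, -, -⟩ := (M.field_eq_zero_iff_steady xs (fun i => (hkP i).ne')
    (fun i => (hτP i).ne') (fun i => (hτQ i).ne')).1 heq
  have hxs : ((xs.1, 0, xs.2.2) : State n) = xs :=
    Prod.ext rfl (Prod.ext (funext fun i => (hω i).symm) rfl)
  set f : SyncDom n → SyncUnk n := M.syncMap xs i₀ with hf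
  set y₀ : SyncUnk n := (xs.1, xs.2.2, 0) with hy₀
  set u₀ : SyncDom n := (0, y₀) with hu₀
  have dfu : HasStrictFDerivAt f (fderiv ℝ f u₀) u₀ :=
    (M.contDiff_syncMap xs i₀).contDiffAt.hasStrictFDerivAt one_ne_zero
  -- identify the partial derivative in the unknowns
  have hpart : HasFDerivAt (fun y : SyncUnk n => f (0, y)) (M.syncJac xs i₀) y₀ := by
    have h := M.hasFDerivAt_syncMap_inr xs i₀ (xs.1, xs.2.2, 0)
    simp only at h
    rw [hxs] at h
    exact h
  have hcomp : HasFDerivAt (fun y : SyncUnk n => f (0, y))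
      ((fderiv ℝ f u₀).comp (ContinuousLinearMap.inr ℝ (Fin n → Fin n → ℝ) (SyncUnk n))) y₀ := by
    have h := dfu.hasFDerivAt.comp y₀
      ((ContinuousLinearMap.inr ℝ (Fin n → Fin n → ℝ) (SyncUnk n)).hasFDerivAt (x := y₀))
    refine h.congr_of_eventuallyEq (Filter.Eventually.of_forall fun y => ?_)
    simp
  have hK : (fderiv ℝ f u₀).comp (ContinuousLinearMap.inr ℝ (Fin n → Fin n → ℝ) (SyncUnk n))
      = M.syncJac xs i₀ := hcomp.unique hpart
  have hinv : ((fderiv ℝ f u₀) ∘L ContinuousLinearMap.inr ℝ (Fin n → Fin n → ℝ) (SyncUnk n)).IsInvertible := by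
    rw [hK]; exact M.isInvertible_syncJac hB hkP hτP hkQ hτQ heq hV i₀ hpos
  have hf0 : f u₀ = 0 := M.syncMap_base hkP hτP hτQ heq i₀
  have hiff := dfu.eventually_apply_eq_iff_implicitFunctionOfProdDomain hinv
  have hstrict := dfu.hasStrictFDerivAt_implicitFunctionOfProdDomain hinv
  have hsol := dfu.eventually_apply_implicitFunctionOfProdDomain hinv
  set Ψ := dfu.implicitFunctionOfProdDomain hinv with hΨ
  have hu₀1 : u₀.1 = (0 : Fin n → Fin n → ℝ) := rfl
  rw [hu₀1] at hstrict hsol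
  have hΨ0 : Ψ 0 = y₀ := (hiff.self_of_nhds).1 rfl
  refine ⟨Ψ, hΨ0, ⟨_, hstrict⟩, ?_, ?_⟩
  · -- positivity of the voltages by continuity, and the solution property
    have hcont : Tendsto Ψ (𝓝 0) (𝓝 y₀) := by
      have := hstrict.continuousAt.tendsto
      rwa [hΨ0] at this
    have hVpos : ∀ i, ∀ᶠ G in 𝓝 (0 : Fin n → Fin n → ℝ), 0 < (Ψ G).2.1 i := by
      intro i
      have ht : Tendsto (fun G => (Ψ G).2.1 i) (𝓝 0) (𝓝 (xs.2.2 i)) :=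
        ((continuous_apply i).continuousAt.tendsto.comp
          (continuousAt_fst.tendsto.comp (continuousAt_snd.tendsto.comp hcont)))
      exact ht.eventually_const_lt (hV i)
    filter_upwards [Filter.eventually_all.2 hVpos, hsol] with G hVG hG
    rw [hf0] at hG
    obtain ⟨hs, hg⟩ := (M.syncMap_eq_zero_iff hkP hτP hτQ xs i₀ G (Ψ G)).1 hG
    exact ⟨hVG, hg, hs⟩
  · filter_upwards [hiff] with p hp
    rw [hf0] at hp
    rw [← hp]
    have e : p = (p.1, p.2) := rfl
    rw [e]
    exact (M.syncMap_eq_zero_iff hkP hτP hτQ xs i₀ p.1 p.2).symm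

end DroopPH

end Literature.MathematicalPhysics.PowerSystems
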